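/-
Copyright (c) 2026 the pub-hodgecm-mathlib formalisation cell (harness21).  Typer seat hodgecm-mathlib-typ-T5a (g0), topic T5 = P8
«(C♯)hol interior», 2026-08-31.  Statement-only Literature module: ONE named fact, no proof.
-/
import Literature.NumberTheory.Automorphic.Liu2021.ThetaLiftFromLineMeets
import HarnessLib

/-!
# [Liu2021, Prop. 4.13 proof Case 1 via Thm. B.4 ∕ Cor. B.5 ∕ Cor. B.6 (1); = Bergeron–Millson–Moeglin 2016 Prop. 13.4 in degree one;
# n = 3: Gelbart–Rogawski 1991 Thm. 5.1.1] — a HOLOMORPHIC `H¹`-cohomological discrete automorphic representation of the anisotropic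
# `U(H)`, `n = 3`, IS A GLOBAL THETA LIFT FROM A ONE-DIMENSIONAL (skew-)HERMITIAN SPACE (letter A = node D1 of the (C♯)hol interior)

Topic `NumberTheory/Automorphic/Liu2021`; namespace `Literature.NumberTheory.Automorphic.Liu2021`.  STATEMENT-ONLY: ONE closed named
fact `def cohHol_meetsThetaLiftFromLine : Prop` (no `sorry`, no instance, no notation); imports = tree (★ `ThetaLiftFromLineMeets`:
the seam predicate `MeetsThetaLiftFromLine`, and through it ★ `UnitaryGroupCohomologicalForms` for `IsHolCotangentAt`, `cmArchSection`,
`cmCompactFactor`).  Cell hodgecm-mathlib FLOOR 0, programme P2, topic T5 = P8: the D1 HALF of the printed proof behind the booked letter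
(C♯)hol `Literature.NumberTheory.Rogawski1990.cohFinComponent_isThetaSigned_hol` (★ p824128).  Frame = that letter's frame VERBATIM
(`L` CM with `[L⁺:ℚ] ≥ 2`, `ι`, `H ∈ M₃(L)` of signature `(2,1)` at `ι` through `T` and positive definite at the other complex places,
`e₁`, a real non-zero diagonal frame `dV` of `H` through `g ∈ GL₃(L)`), plus the ADELIC frame transport `ιA : k ↦ g_𝔸⁻¹ k g_𝔸`
(`U(H)(𝔸) →* U(diag dV)(𝔸)`, pinned extensionally through ★ `adelicVal` ∕ ★ `toAdeleGL`, as (C♯)hol pins its finite-adelic `ιV`).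

PRINT.  [Liu2021, proof of Prop. 4.13, FJcycle.tex l. 2129–2136; Camb. J. Math. 9 (2021) pp. 47–48]: «By the proof of [BMM]*Proposition
13.4 (with `m = n`, `p = n−1`, `q = 1`, `a+b = 1`), we know that there exists a strictly unitary automorphic character `μ` … such that the
partial `L`-function `L^S(s, π × μ)` has a simple pole at `s₀` with `s₀ ≥ n/2` … [footnote: `π` is assumed to be cuspidal in the statement
of [BMM, Prop. 13.4]. However, this step works for `π` discrete.]  Case 1. Suppose that `π` contributes to the Albanese and `m_cusp(π) > 0`.
Let `V_π` be a cuspidal realization of `π`.  By Corollary B.5, `s₀` is either `(n+1)/2` or `n/2`, not both.  If `s₀ = (n+1)/2`, then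
Theorem B.4 implies that `Θ^W_{(μ,ν),V}(V_π) ≠ {0}`, where `W` is the zero skew-hermitian space.  By Corollary B.6 (1), `V_π` is a character,
hence `H¹(𝔤, K_G; π_∞) = {0}`, which is a contradiction.  Thus, we must have `s₀ = n/2`.  By Theorem B.4, we have a one-dimensional
skew-hermitian space `W` such that `Θ^W_{(μ,ν),V}(V_π)` [`≠ 0`] and is cuspidal.  By Corollary B.6 (1), we have
`V_π = Θ^V_{(μ⁻¹,ν⁻¹),−W}(π_W)`.»  The three App. B inputs, AS PRINTED (pp. 98–99): Thm. B.4 (th:pole) «(1) … (a) `L^S(s, π×μ)·L^S(2s, μ,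
As^{(−1)^n})` has a pole at `s₀` … (c) `Θ^W_{(μ,ν),V}(V_π) ≠ 0` for some skew-hermitian space `W` of dimension `n+1−2s₀` … Then (a) ⇒ (b) ⇒ (c).
(2) The skew-hermitian space `W` in (1c) is unique up to isomorphism.» (proof §B.3 after [GinzburgJiangSoudry2009]); Cor. B.5 (co:pole1) «(3)
If `μ` is conjugate symplectic, then `Pol^S_{π,μ} ⊂ {n/2, (n−2)/2, …}`»; Cor. B.6 (co:pole2) (1) «Suppose that `Θ^W_{(μ,ν),V}(V_π)` is
cuspidal. Then [it] is an irreducible representation of `U(W)(𝔸_F)`; and `V_π = Θ^V_{(μ⁻¹,ν⁻¹),−W}(Θ^W_{(μ,ν),V}(V_π))`» (from [Wu2013,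
Thm. 5.1, 5.3]).  Case 2 (residual spectrum) «might happen only when `F = ℚ`» (l. 2139) — EXCLUDED here by `[L⁺:ℚ] ≥ 2` (then `U(H)` is
anisotropic: compact automorphic quotient, `L²_disc = L²_cusp = L²`).  For `n = 3` the same statement is [Liu2021, Rem. 4.14] «can be
deduced from [GR91, Rog92]»: [Rogawski1990, Thm. 13.3.6 (c) p. 201; §15.3 ¶1 p. 250] (the `H¹`-cohomological spectrum of the inner form
lies in `⋃_ξ Π′(ξ)`, `dim ξ = 1`) ∘ [GelbartRogawski1991, Thm. 5.1.1 p. 465, Lem. 5.1.2 p. 466] (the automorphic members of `Π(ξ)` are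
Howe–Piatetski-Shapiro theta lifts from `U(1)`).  BMM's form: [BergeronMillsonMoeglin2016Balls, Prop. 13.4 (arXiv:1306.1515 Part 3);
Thm. 7.2 p. 65] «Let `π ∈ 𝒜^c(U(V))` … Assume that `π_v` is (isomorphic to) the cohomological representation `A(b×q, a×q)` of `U(p,q)`
with `3(a+b)+|a−b| < 2m`. Then, there exists some `(a+b)`-dimensional skew-Hermitian space `W` over `E` such that `π` is in the image of
the cuspidal `ψ`-theta correspondence from the group `U(W)`» (here `m = 3`, `(p,q) = (2,1)`, `(a,b) = (0,1)`: `3·1+1 = 4 < 6`; typed at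
DICTIONARY level as ★ `BergeronMillsonMoeglin2016.BMMArchSpectrum.Prop_13_4` — this file is its F0-currency instance in degree one).

TYPING (the tree's reading, nothing re-declared).  «`π` contributes and is holomorphic» = ★ `P.IsHolCotangentAt (cmArchSection …)
(cmCompactFactor …)` (a non-zero HOLOMORPHIC cotangent form lies in `P`; (C♯)hol's hypothesis verbatim); «`V_π = Θ^V_{(μ⁻¹,ν⁻¹),−W}(π_W)`
for a one-dimensional skew-hermitian `W`» = ★ `MeetsThetaLiftFromLine L 3 H e₁ dV hdV hdV0 P μ hμ a ιA` for SOME conjugate-symplectic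
`μ : C_L →ₜ* S¹` (★ `IsConjugateSymplectic`; Liu's splitting character of `U(V)`, «replaced by its inverse», footnote l. 2136) and SOME
line `a ∈ (L⁺)ˣ` (`W = ⟨a·δ′⟩`, [Liu2021, App. D Step 1]); the second splitting character `ν` only twists the lift by a character of
`U(W)` (Thm. B.4 footnote, l. 4289) and is absorbed by the weight `f` of the predicate.  The compactness instance `[U(diag dV)]` compact is
a displayed binder (in house: ★ `AnisotropicUnitaryGroupCompactOfPlace`, `H` being definite at a place).

HONEST SCOPE.  (i) This is a DEEP letter: its printed proof runs through the pole of `L^S(s, π × μ)` ([BMM] Prop. 13.4's proof uses Arthur's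
endoscopic classification, Acta §1.4; for `n = 3` Rogawski's), the Siegel–Weil ∕ Eisenstein-series method of [GinzburgJiangSoudry2009] (Thm.
B.4) and [Wu2013] (Cor. B.6) — none of which has a carrier in the tree (no partial `L`-function of an automorphic representation of a
unitary group, no Eisenstein series on `U(V ⊕ D)`); they are recorded here as the PRINTED ROAD, not typed.  (ii) Junk models: without
`IsHolCotangentAt` the statement is false (a supercuspidal-at-some-place `P` is no theta lift from `U(1)`); without `[L⁺:ℚ] ≥ 2` the residual
Case 2 would be needed; over an `ιA` not pinned by `hιA` it would be about the wrong group.  (iii) The conclusion is an `∃` over `(μ, a)` and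
over the predicate's witness slots (majorants, measure, weight, Schwartz function) — it asserts the EXISTENCE of one non-zero theta vector in
`P`, which is exactly what nodes (B) and (C) of the T5 tree consume.  HC_CM is proved only modulo the printed citations until rung 0 closes;
filing this file books ONE printed statement (pay-down road: none in the tree today).

## References
* [Liu2021] Y. Liu, Camb. J. Math. 9 (2021) = arXiv:2102.11518: proof of Prop. 4.13 (l. 2121–2146, pp. 47–48), Rem. 4.14 (p. 49); App. B:
  Def. B.2, Thm. B.4 (p. 98), Cor. B.5 (p. 98), Cor. B.6 (p. 99), §B.3.
* [BergeronMillsonMoeglin2016Balls] N. Bergeron, J. Millson, C. Moeglin, Acta Math. 216 (2016) 1–125: Thm. 7.2 p. 65, Prop. 13.4.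
* [Rogawski1990] J. Rogawski, Ann. of Math. Stud. 123 (1990): Thm. 13.3.6 (c) p. 201, §15.3 ¶1 p. 250.
* [GelbartRogawski1991] S. Gelbart, J. Rogawski, Invent. Math. 105 (1991): Thm. 5.1.1 p. 465, Lem. 5.1.2 p. 466.
* [GinzburgJiangSoudry2009] D. Ginzburg, D. Jiang, D. Soudry, *Poles of L-functions and theta liftings for orthogonal groups*, J. Inst.
  Math. Jussieu 8 (2009) 693–741, Thm. 1.1 (Liu's [GJS]).
* [Wu2013] C. Wu, *Irreducibility of theta lifting for unitary groups*, J. Number Theory 133 (2013) 3296–3318, Thm. 5.1, 5.3 (Liu's [Wu13]).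
-/

noncomputable section

open NumberField NumberField.InfinitePlace MeasureTheory IsDedekindDomain
open scoped Matrix ComplexOrder

namespace Literature.NumberTheory.Automorphic.Liu2021

open _root_.MeasureTheory
open Literature.NumberTheory.Automorphic Literature.NumberTheory.Automorphic.UnitaryGroup
open Literature.NumberTheory.Automorphic.UnitaryGroup.CotangentForms
open Literature.NumberTheory.Automorphic.IdeleClassGroup

/-- **Letter A (node D1 of the (C♯)hol interior) [Liu2021, Prop. 4.13 proof Case 1 via Thm. B.4, Cor. B.5, Cor. B.6 (1);
BergeronMillsonMoeglin2016 Prop. 13.4 at `a+b = 1`; `n = 3`: Rogawski1990 Thm. 13.3.6 (c) + GelbartRogawski1991 Thm. 5.1.1] —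
«`V_π = Θ^V_{(μ⁻¹,ν⁻¹),−W}(π_W)` for a one-dimensional skew-hermitian `W`»: in the frame of (C♯)hol (`[L⁺:ℚ] ≥ 2`, `H` of signature
`(2,1)` at `ι`, definite elsewhere; diagonal frame `dV` through `g`; adelic transport `ιA = (k ↦ g_𝔸⁻¹ k g_𝔸)`), every discrete automorphic
`P` of `U(H)(𝔸_{L⁺})` that is `H¹`-cohomological of HOLOMORPHIC type at `ι` (★ `IsHolCotangentAt`) MEETS THE GLOBAL THETA CORRESPONDENCE
from some hermitian line `⟨a⟩`, `a ∈ (L⁺)ˣ`, at the splitting attached to some conjugate-symplectic `μ` (★ `MeetsThetaLiftFromLine`).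
[cite: Liu2021, Prop. 4.13 proof Case 1 (l. 2129–2136, pp. 47–48); Thm. B.4 p. 98; Cor. B.5 p. 98; Cor. B.6 (1) p. 99; Rem. 4.14 p. 49]
[cite: BergeronMillsonMoeglin2016Balls, Prop. 13.4; Thm. 7.2 p. 65] [cite: Rogawski1990, Thm. 13.3.6 (c) p. 201; §15.3 ¶1 p. 250]
[cite: GelbartRogawski1991, Thm. 5.1.1 p. 465; Lem. 5.1.2 p. 466] -/
def cohHol_meetsThetaLiftFromLine : Prop :=
  ∀ (L : Type) [Field L] [NumberField L] [IsCMField L] (ι : L →+* ℂ) (H : Matrix (Fin 3) (Fin 3) L) (T : GL (Fin 3) ℂ)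
    (hT : (T : Matrix (Fin 3) (Fin 3) ℂ)ᴴ * H.map ι * (T : Matrix (Fin 3) (Fin 3) ℂ) = Literature.Geometry.ComplexHyperbolic.BallModel.J),
    (∀ τ' : L →+* ℂ, InfinitePlace.mk τ' ≠ InfinitePlace.mk ι → (H.map τ').PosDef) → 2 ≤ Module.finrank ℚ ↥(maximalRealSubfield L) →
    ∀ {n' : ℕ} (e₁ : Fin 3 × Fin 1 ≃ Fin n') (dV : Fin 3 → L) (hdV : ∀ i, IsCMField.complexConj L (dV i) = dV i)
      (hdV0 : ∀ i, dV i ≠ 0) (g : GL (Fin 3) L),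
      ((g : Matrix (Fin 3) (Fin 3) L).map (cmConjRingHom L))ᵀ * H * (g : Matrix (Fin 3) (Fin 3) L) = Matrix.diagonal dV →
    ∀ (ιA : (adelicGroupData (↥(maximalRealSubfield L)) L (IsCMField.complexConj L) 3 H).Adelic →*
        ↥(UnitaryGroup.adelic (↥(maximalRealSubfield L)) L (IsCMField.complexConj L) 3 (Matrix.diagonal dV))),
      (∀ k, ((ιA k : ↥(UnitaryGroup.adelic (↥(maximalRealSubfield L)) L (IsCMField.complexConj L) 3 (Matrix.diagonal dV))) :
            GL (Fin 3) (AdeleRing (𝓞 L) L)) =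
          (toAdeleGL L g)⁻¹ * adelicVal (↥(maximalRealSubfield L)) L (IsCMField.complexConj L) 3 H k * toAdeleGL L g) →
    ∀ [CompactSpace (↥(UnitaryGroup.adelic (↥(maximalRealSubfield L)) L (IsCMField.complexConj L) 3 (Matrix.diagonal dV)) ⧸
        (UnitaryGroup.toAdelic (↥(maximalRealSubfield L)) L (IsCMField.complexConj L) 3 (Matrix.diagonal dV)).range)],
    ∀ (μA : Measure (adelicGroupData (↥(maximalRealSubfield L)) L (IsCMField.complexConj L) 3 H).automorphicQuotient)
      [(adelicGroupData (↥(maximalRealSubfield L)) L (IsCMField.complexConj L) 3 H).IsAutomorphicMeasure μA],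
      ∀ P : DiscreteAutomorphicRep (adelicGroupData (↥(maximalRealSubfield L)) L (IsCMField.complexConj L) 3 H) μA,
        P.IsHolCotangentAt (cmArchSection L ι H T hT) (cmCompactFactor L ι H T hT) →
          ∃ (μ : Literature.NumberTheory.Automorphic.IdeleClassGroup L →ₜ* Circle) (hμ : IsConjugateSymplectic L μ)
            (a : (↥(maximalRealSubfield L))ˣ),
            MeetsThetaLiftFromLine L 3 H e₁ dV hdV hdV0 P μ hμ a ιA

end Literature.NumberTheory.Automorphic.Liu2021

end
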